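import Mathlib
import HarnessLib
import Summits.HubbardSuperconductivity.HubbardSuperconductivity.Theorems.KLProgrammeH10TwoPointLimitFrameTorusBridge
import Literature.MathematicalPhysics.QuantumLattice.HubbardSectorFieldSubstitution

/-!
# Route `KLProgramme` — crux K1 `H10TwoPointLimit` (stmt-HubbardSuperconductivity-19938) / K3's ENGINE child (19662):
# the multiplier row/column sums `hrow′/hcol′` of the single-scale step — STRUCTURAL REDUCTION to (sector-overlap count) ×
# (ℓ¹ size of ONE two-multiplier kernel), and the OVERLAP COUNTS for the engine's angular families on any frame

Cell `gate-hubbard-kl`, seat p4 (C5a lead), g5; answer to p1 g6's (Q)-ruling 2026-08-26T18:25:07Z («package (ii): the row/column sums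
`hrow′/hcol′` of `sectorAnalysisMatrix * sectorSubMatrix` in `hubbardSectorKernelNorm_effAction_le`, for the ANISOTROPIC family on
admissible frames»).  The overlap kernel is `(E′S)((y,ℓ′),(x,ℓ)) = [σ, c equal] Σ_k F′_{ω′}(k) e^{-is_c k·y} (βL²)⁻¹ F_ω(k) conj(e^{-is_c k·x})`
(`sectorAnalysis_mul_sectorSub_apply`).  This file separates the COMBINATORIAL part (how many sectors `ω` of `F` can meet a sector
`ω′` of `F′`) from the ANALYTIC part (the `ℓ¹(x)` size `B` of one kernel, BGM (2.71a) — owed by the sector-propagator lane), and proves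
the combinatorial part for every pair of the engine's families, on EVERY frame (the angular partition does not see the band):

* §1 generic reduction (any families `F′`, `F`): if sectors of `F′`/`F` with no common support point are discarded (their kernel is `0`,
  `sectorAnalysis_mul_sectorSub_eq_zero_of_disjoint`), then
  `hrow′ ≤ novl · B` (`rowSum_sectorAnalysis_mul_sectorSub_le`) and `hcol′ ≤ novl′ · B′` (`colSum_…`), where `novl` bounds
  `#{ω : ∃ k, F′ ω′ k ≠ 0 ∧ F ω k ≠ 0}` for every `ω′`, `novl′` the transposed count, and `B`, `B′` bound the `x`- resp. `y`-sums of the norms of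
  one kernel at fixed sector pair and spin/charge.
* §2 angular overlap counting (pure `AngularSectors` combinatorics, `sectorIndex_near_of_sectorWeightCirc_ne_zero` +
  `sectorIndex_div_pow`): for angular indices `m ≤ m′`, a smooth sector of index `m′` meets at most `9` smooth sectors of index `m`
  (`card_coarse_overlap_le`), and a smooth sector of index `m` meets at most `9·2^{m′−m}` of index `m′` (`card_fine_overlap_le`).
* §3 the engine's families on a frame `K` (`klAnisoFamily … n` = angular index `n`; `klIsoFamily … n` = angular index `2n`;
  `support_klAnisoFamily/klIsoFamily` of `…FrameTorusBridge`): overlap counts `≤ 9` / `≤ 9·2^{Δ}` for aniso–aniso, iso–iso and the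
  mixed pairs, uniformly in the frame, `β`, `μ`, `L`, `M`, `e₀ > 0`.

Everything is PROVED; no definitions, no named facts.  References: BGM 2006 §2.5 (2.45)–(2.48), §2.7 (2.70)–(2.71a), §2.8 (2.76)
[cite: BenfattoGiulianiMastropietro2006]; BGM 2003 §7.4 (s1.23) [cite: BenfattoGiulianiMastropietro2003].
-/

noncomputable section

namespace Summit.HubbardSuperconductivity.HubbardSuperconductivity.Theorems.PerturbedFermiCurve

set_option linter.dupNamespace false -- summit = problem name (single-conjunct summit), D-0017

open Classical
open Real Set Finset
open Literature.MathematicalPhysics.QuantumLattice Literature.Probability.LatticeModels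
open Summit.HubbardSuperconductivity.HubbardSuperconductivity.Theorems.KLProgrammeLegKernels

/-! ## §1 Generic reduction: row/column sums ≤ (overlap count) × (one-kernel `ℓ¹` size) -/

section Generic

variable {L M : ℕ} [NeZero L] {N N' : ℕ}

/-- **Sectors with no common support point contribute nothing**: if no frequency–momentum carries both `F′ ω′` and `F ω`, the
overlap kernel `(E′S)((y,(ω′,σ′,c′)),(x,(ω,σ,c)))` vanishes. [cite: BenfattoGiulianiMastropietro2006, §2.7 (2.71)] -/
theorem sectorAnalysis_mul_sectorSub_eq_zero_of_disjoint (β : ℝ) (F' : Fin N' → FreqMomentum L M → ℂ)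
    (F : Fin N → FreqMomentum L M → ℂ) (Y' : SpaceTimeIdx L M × SectorLeg N') (Y : SpaceTimeIdx L M × SectorLeg N)
    (h : ¬ ∃ k, F' Y'.2.1.1 k ≠ 0 ∧ F Y.2.1.1 k ≠ 0) :
    (sectorAnalysisMatrix L M β F' * sectorSubMatrix L M β F) Y' Y = 0 := by
  rw [sectorAnalysis_mul_sectorSub_apply]
  split_ifs
  · refine Finset.sum_eq_zero fun k _ => ?_
    push Not at h
    by_cases h1 : F' Y'.2.1.1 k = 0
    · rw [h1]; ring
    · rw [h k h1]; ring
  · rfl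

/-- The sum over the substitution-side labels, split into position and leg label. [folklore] -/
theorem sum_spaceTime_sectorLeg_eq (f : SpaceTimeIdx L M × SectorLeg N → ℝ) :
    ∑ Y, f Y = ∑ ω : Fin N, ∑ σ : Fin 2, ∑ c : Fin 2, ∑ x : SpaceTimeIdx L M, f (x, ((ω, σ), c)) := by
  have h1 : ∑ Y, f Y = ∑ x : SpaceTimeIdx L M, ∑ ℓ : SectorLeg N, f (x, ℓ) := Fintype.sum_prod_type f
  have h3 : ∀ x : SpaceTimeIdx L M, ∑ ωσ : Fin N × Fin 2, ∑ c : Fin 2, f (x, (ωσ, c)) =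
      ∑ ω : Fin N, ∑ σ : Fin 2, ∑ c : Fin 2, f (x, ((ω, σ), c)) := fun x =>
    Fintype.sum_prod_type (fun ωσ : Fin N × Fin 2 => ∑ c : Fin 2, f (x, (ωσ, c)))
  rw [h1]
  have h4 : ∀ x : SpaceTimeIdx L M, ∑ ℓ : SectorLeg N, f (x, ℓ) = ∑ ω : Fin N, ∑ σ : Fin 2, ∑ c : Fin 2, f (x, ((ω, σ), c)) := by
    intro x
    rw [Fintype.sum_prod_type (fun ℓ : SectorLeg N => f (x, ℓ))]
    exact h3 x
  simp_rw [h4]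
  rw [Finset.sum_comm]
  refine Finset.sum_congr rfl fun ω _ => ?_
  rw [Finset.sum_comm]
  refine Finset.sum_congr rfl fun σ _ => ?_
  rw [Finset.sum_comm]

/-- **Row sum (`hrow′`) ≤ overlap count × one-kernel size.**  If every sector `ω′` of `F′` meets at most `novl` sectors of `F` (common
support point) and the `x`-sum of the norms of one kernel at fixed `(ω′, ω, σ, c, y)` is `≤ B`, then for every row index `Y′`:
`Σ_Y ‖(E′S) Y′ Y‖ ≤ novl·B`. [cite: BenfattoGiulianiMastropietro2006, §2.7 (2.71a)] -/
theorem rowSum_sectorAnalysis_mul_sectorSub_le (β : ℝ) (F' : Fin N' → FreqMomentum L M → ℂ)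
    (F : Fin N → FreqMomentum L M → ℂ) {novl : ℕ}
    (hovl : ∀ ω' : Fin N', ((Finset.univ : Finset (Fin N)).filter
      (fun ω => ∃ k, F' ω' k ≠ 0 ∧ F ω k ≠ 0)).card ≤ novl)
    {B : ℝ} (hB0 : 0 ≤ B)
    (hB : ∀ (ω' : Fin N') (ω : Fin N) (σ c : Fin 2) (y : SpaceTimeIdx L M),
      ∑ x : SpaceTimeIdx L M, ‖(sectorAnalysisMatrix L M β F' * sectorSubMatrix L M β F) (y, ((ω', σ), c)) (x, ((ω, σ), c))‖ ≤ B)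
    (Y' : SpaceTimeIdx L M × SectorLeg N') :
    ∑ Y, ‖(sectorAnalysisMatrix L M β F' * sectorSubMatrix L M β F) Y' Y‖ ≤ novl * B := by
  obtain ⟨y, ⟨ω', σ'⟩, c'⟩ := Y'
  rw [sum_spaceTime_sectorLeg_eq]
  -- only `(σ, c) = (σ′, c′)` contributes
  have hvan : ∀ (ω : Fin N) (σ c : Fin 2) (x : SpaceTimeIdx L M), ¬ (σ = σ' ∧ c = c') →
      ‖(sectorAnalysisMatrix L M β F' * sectorSubMatrix L M β F) (y, ((ω', σ'), c')) (x, ((ω, σ), c))‖ = 0 := by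
    intro ω σ c x hne
    rw [sectorAnalysis_mul_sectorSub_apply, if_neg (by simpa using hne), norm_zero]
  have hω : ∀ ω : Fin N, ∑ σ : Fin 2, ∑ c : Fin 2, ∑ x : SpaceTimeIdx L M,
      ‖(sectorAnalysisMatrix L M β F' * sectorSubMatrix L M β F) (y, ((ω', σ'), c')) (x, ((ω, σ), c))‖ =
      ∑ x : SpaceTimeIdx L M, ‖(sectorAnalysisMatrix L M β F' * sectorSubMatrix L M β F) (y, ((ω', σ'), c')) (x, ((ω, σ'), c'))‖ := by
    intro ω
    rw [Finset.sum_eq_single σ', Finset.sum_eq_single c']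
    · intro c _ hc; exact Finset.sum_eq_zero fun x _ => hvan ω σ' c x (by simp [hc])
    · simp
    · intro σ _ hσ; exact Finset.sum_eq_zero fun c _ => Finset.sum_eq_zero fun x _ => hvan ω σ c x (by simp [hσ])
    · simp
  simp_rw [hω]
  -- split `ω` into overlapping / non-overlapping
  set S := (Finset.univ : Finset (Fin N)).filter (fun ω => ∃ k, F' ω' k ≠ 0 ∧ F ω k ≠ 0) with hS
  have hsplit : ∑ ω : Fin N, ∑ x : SpaceTimeIdx L M,
      ‖(sectorAnalysisMatrix L M β F' * sectorSubMatrix L M β F) (y, ((ω', σ'), c')) (x, ((ω, σ'), c'))‖ =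
      ∑ ω ∈ S, ∑ x : SpaceTimeIdx L M,
      ‖(sectorAnalysisMatrix L M β F' * sectorSubMatrix L M β F) (y, ((ω', σ'), c')) (x, ((ω, σ'), c'))‖ := by
    symm
    refine Finset.sum_subset (Finset.filter_subset _ _) fun ω _ hω => Finset.sum_eq_zero fun x _ => ?_
    rw [hS, Finset.mem_filter, not_and] at hω
    rw [sectorAnalysis_mul_sectorSub_eq_zero_of_disjoint β F' F _ _ (hω (Finset.mem_univ ω)), norm_zero]
  rw [hsplit]
  calc _ ≤ ∑ ω ∈ S, B := Finset.sum_le_sum fun ω _ => hB ω' ω σ' c' y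
    _ = S.card * B := by rw [Finset.sum_const, nsmul_eq_mul]
    _ ≤ novl * B := mul_le_mul_of_nonneg_right (by exact_mod_cast hovl ω') hB0

/-- **Column sum (`hcol′`) ≤ transposed overlap count × one-kernel size.**  If every sector `ω` of `F` meets at most `novl′` sectors of
`F′` and the `y`-sum of the norms of one kernel at fixed `(ω′, ω, σ, c, x)` is `≤ B′`, then for every column index `Y`:
`Σ_{Y′} ‖(E′S) Y′ Y‖ ≤ novl′·B′`. [cite: BenfattoGiulianiMastropietro2006, §2.7 (2.71a)] -/
theorem colSum_sectorAnalysis_mul_sectorSub_le (β : ℝ) (F' : Fin N' → FreqMomentum L M → ℂ)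
    (F : Fin N → FreqMomentum L M → ℂ) {novl' : ℕ}
    (hovl : ∀ ω : Fin N, ((Finset.univ : Finset (Fin N')).filter
      (fun ω' => ∃ k, F' ω' k ≠ 0 ∧ F ω k ≠ 0)).card ≤ novl')
    {B' : ℝ} (hB0 : 0 ≤ B')
    (hB : ∀ (ω' : Fin N') (ω : Fin N) (σ c : Fin 2) (x : SpaceTimeIdx L M),
      ∑ y : SpaceTimeIdx L M, ‖(sectorAnalysisMatrix L M β F' * sectorSubMatrix L M β F) (y, ((ω', σ), c)) (x, ((ω, σ), c))‖ ≤ B')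
    (Y : SpaceTimeIdx L M × SectorLeg N) :
    ∑ Y', ‖(sectorAnalysisMatrix L M β F' * sectorSubMatrix L M β F) Y' Y‖ ≤ novl' * B' := by
  obtain ⟨x, ⟨ω, σ⟩, c⟩ := Y
  rw [sum_spaceTime_sectorLeg_eq]
  have hvan : ∀ (ω' : Fin N') (σ' c' : Fin 2) (y : SpaceTimeIdx L M), ¬ (σ' = σ ∧ c' = c) →
      ‖(sectorAnalysisMatrix L M β F' * sectorSubMatrix L M β F) (y, ((ω', σ'), c')) (x, ((ω, σ), c))‖ = 0 := by
    intro ω' σ' c' y hne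
    rw [sectorAnalysis_mul_sectorSub_apply, if_neg (by
      rintro ⟨h1, h2⟩; exact hne ⟨h1.symm, h2.symm⟩), norm_zero]
  have hω : ∀ ω' : Fin N', ∑ σ' : Fin 2, ∑ c' : Fin 2, ∑ y : SpaceTimeIdx L M,
      ‖(sectorAnalysisMatrix L M β F' * sectorSubMatrix L M β F) (y, ((ω', σ'), c')) (x, ((ω, σ), c))‖ =
      ∑ y : SpaceTimeIdx L M, ‖(sectorAnalysisMatrix L M β F' * sectorSubMatrix L M β F) (y, ((ω', σ), c)) (x, ((ω, σ), c))‖ := by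
    intro ω'
    rw [Finset.sum_eq_single σ, Finset.sum_eq_single c]
    · intro c' _ hc; exact Finset.sum_eq_zero fun y _ => hvan ω' σ c' y (by simp [hc])
    · simp
    · intro σ' _ hσ; exact Finset.sum_eq_zero fun c' _ => Finset.sum_eq_zero fun y _ => hvan ω' σ' c' y (by simp [hσ])
    · simp
  simp_rw [hω]
  set S := (Finset.univ : Finset (Fin N')).filter (fun ω' => ∃ k, F' ω' k ≠ 0 ∧ F ω k ≠ 0) with hS
  have hsplit : ∑ ω' : Fin N', ∑ y : SpaceTimeIdx L M,
      ‖(sectorAnalysisMatrix L M β F' * sectorSubMatrix L M β F) (y, ((ω', σ), c)) (x, ((ω, σ), c))‖ =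
      ∑ ω' ∈ S, ∑ y : SpaceTimeIdx L M,
      ‖(sectorAnalysisMatrix L M β F' * sectorSubMatrix L M β F) (y, ((ω', σ), c)) (x, ((ω, σ), c))‖ := by
    symm
    refine Finset.sum_subset (Finset.filter_subset _ _) fun ω' _ hω' => Finset.sum_eq_zero fun y _ => ?_
    rw [hS, Finset.mem_filter, not_and] at hω'
    rw [sectorAnalysis_mul_sectorSub_eq_zero_of_disjoint β F' F _ _ (hω' (Finset.mem_univ ω')), norm_zero]
  rw [hsplit]
  calc _ ≤ ∑ ω' ∈ S, B' := Finset.sum_le_sum fun ω' _ => hB ω' ω σ c x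
    _ = S.card * B' := by rw [Finset.sum_const, nsmul_eq_mul]
    _ ≤ novl' * B' := mul_le_mul_of_nonneg_right (by exact_mod_cast hovl ω) hB0

end Generic

/-! ## §2 Angular overlap counting -/

/-- From `N ∣ (s − ω − d)` with `0 ≤ ω < N`: `ω = (s − d) mod N`. [folklore] -/
theorem eq_emod_of_dvd_sub {N : ℕ} {s ω d : ℤ} (hω0 : 0 ≤ ω) (hωN : ω < N) (h : (N : ℤ) ∣ (s - ω - d)) :
    ω = (s - d) % (N : ℤ) := by
  obtain ⟨q, hq⟩ := h
  have e : s - d = ω + q * (N : ℤ) := by linarith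
  rw [e, Int.add_mul_emod_self_right, Int.emod_eq_of_lt hω0 hωN]

/-- **A smooth sector of angular index `m′` meets at most `9` smooth sectors of a coarser index `m ≤ m′`** (their labels, as a subset of
`Fin (sectorCount m)`): if `ζ̃_{m′,ω′}(θ) ≠ 0` and `ζ̃_{m,ω}(θ) ≠ 0` at a common angle then `ω ≡ ⌊sectorIndex m′ θ / 2^{m′−m}⌋ + d` with the
fine index `≡ ω′ + d′`, `|d|, |d′| ≤ 1`. [cite: BenfattoGiulianiMastropietro2003, §7.4 (s1.23)] -/
theorem card_coarse_overlap_le {m m' : ℕ} (hmm : m ≤ m') (ω' : Fin (sectorCount m')) :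
    ((Finset.univ : Finset (Fin (sectorCount m))).filter (fun ω : Fin (sectorCount m) =>
      ∃ θ : ℝ, sectorWeightCirc m' ((ω' : ℕ) : ℤ) θ ≠ 0 ∧ sectorWeightCirc m ((ω : ℕ) : ℤ) θ ≠ 0)).card ≤ 9 := by
  have hN : 0 < sectorCount m := sectorCount_pos m
  have hN' : 0 < sectorCount m' := sectorCount_pos m'
  -- the candidate map `(d′, d) ↦ ((⌊((ω′ + d′ − 1) mod N′) / 2^{m′−m}⌋ + d − 1) mod N)`
  let g : Fin 3 × Fin 3 → ℤ := fun dd =>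
    ((((((((ω' : ℕ) : ℤ) + ((dd.1 : ℕ) : ℤ) - 1) % (sectorCount m' : ℤ)).toNat / 2 ^ (m' - m) : ℕ) : ℤ) +
      ((dd.2 : ℕ) : ℤ) - 1) % (sectorCount m : ℤ))
  have hg0 : ∀ dd, 0 ≤ g dd := fun dd => Int.emod_nonneg _ (by exact_mod_cast hN.ne')
  have hg1 : ∀ dd, g dd < sectorCount m := fun dd => Int.emod_lt_of_pos _ (by exact_mod_cast hN)
  let f : Fin 3 × Fin 3 → Fin (sectorCount m) := fun dd => ⟨(g dd).toNat, by have := hg0 dd; have := hg1 dd; omega⟩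
  have hsub : (Finset.univ : Finset (Fin (sectorCount m))).filter (fun ω : Fin (sectorCount m) =>
      ∃ θ : ℝ, sectorWeightCirc m' ((ω' : ℕ) : ℤ) θ ≠ 0 ∧ sectorWeightCirc m ((ω : ℕ) : ℤ) θ ≠ 0) ⊆ Finset.univ.image f := by
    intro ω hω
    rw [Finset.mem_filter] at hω
    obtain ⟨θ, h1, h2⟩ := hω.2
    obtain ⟨d', hd', hdiv'⟩ := sectorIndex_near_of_sectorWeightCirc_ne_zero h1
    obtain ⟨d, hd, hdiv⟩ := sectorIndex_near_of_sectorWeightCirc_ne_zero h2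
    rw [Finset.mem_image]
    have hd'r : 0 ≤ 1 + d' ∧ 1 + d' ≤ 2 := by rw [abs_le] at hd'; omega
    have hdr : 0 ≤ 1 - d ∧ 1 - d ≤ 2 := by rw [abs_le] at hd; omega
    refine ⟨(⟨(1 + d').toNat, by omega⟩, ⟨(1 - d).toNat, by omega⟩), Finset.mem_univ _, ?_⟩
    apply Fin.ext
    show (g (⟨(1 + d').toNat, by omega⟩, ⟨(1 - d).toNat, by omega⟩)).toNat = (ω : ℕ)
    -- the fine index: `s′ = (ω′ + d′) mod N′`
    have hs'lt : sectorIndex m' θ < sectorCount m' := sectorIndex_lt m' θ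
    have hc' : (((1 + d').toNat : ℕ) : ℤ) = 1 + d' := Int.toNat_of_nonneg hd'r.1
    have hidx' : ((sectorIndex m' θ : ℕ) : ℤ) =
        (((ω' : ℕ) : ℤ) + (((1 + d').toNat : ℕ) : ℤ) - 1) % (sectorCount m' : ℤ) := by
      rw [hc']
      have := eq_emod_of_dvd_sub (s := ((ω' : ℕ) : ℤ) + d') (ω := ((sectorIndex m' θ : ℕ) : ℤ)) (d := 0)
        (by positivity) (by exact_mod_cast hs'lt) (by obtain ⟨q, hq⟩ := hdiv'; exact ⟨-q, by linarith⟩)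
      rw [this]; ring_nf
    have htoNat : ((((ω' : ℕ) : ℤ) + (((1 + d').toNat : ℕ) : ℤ) - 1) % (sectorCount m' : ℤ)).toNat = sectorIndex m' θ := by
      rw [← hidx']; simp
    -- the coarse index: `s = s′ / 2^{m′−m}` and `ω = (s − d) mod N`
    have hss' : sectorIndex m θ = sectorIndex m' θ / 2 ^ (m' - m) := sectorIndex_div_pow hmm θ
    have hωlt : ((ω : ℕ) : ℤ) < sectorCount m := by exact_mod_cast ω.isLt
    have hc : (((1 - d).toNat : ℕ) : ℤ) = 1 - d := Int.toNat_of_nonneg hdr.1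
    have hω : ((ω : ℕ) : ℤ) = (((sectorIndex m θ : ℕ) : ℤ) + (((1 - d).toNat : ℕ) : ℤ) - 1) % (sectorCount m : ℤ) := by
      rw [hc]
      have := eq_emod_of_dvd_sub (s := ((sectorIndex m θ : ℕ) : ℤ)) (ω := ((ω : ℕ) : ℤ)) (d := d) (by positivity) hωlt hdiv
      rw [this]; ring_nf
    have hgval : g (⟨(1 + d').toNat, by omega⟩, ⟨(1 - d).toNat, by omega⟩) =
        (((sectorIndex m θ : ℕ) : ℤ) + (((1 - d).toNat : ℕ) : ℤ) - 1) % (sectorCount m : ℤ) := by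
      show ((((((((ω' : ℕ) : ℤ) + (((1 + d').toNat : ℕ) : ℤ) - 1) % (sectorCount m' : ℤ)).toNat / 2 ^ (m' - m) : ℕ) : ℤ) +
        (((1 - d).toNat : ℕ) : ℤ) - 1) % (sectorCount m : ℤ)) = _
      rw [htoNat, ← hss']
    rw [hgval, ← hω]
    simp
  calc _ ≤ (Finset.univ.image f).card := Finset.card_le_card hsub
    _ ≤ (Finset.univ : Finset (Fin 3 × Fin 3)).card := Finset.card_image_le
    _ = 9 := by simp

/-- **A smooth sector of angular index `m` meets at most `9·2^{m′−m}` smooth sectors of a finer index `m′ ≥ m`.**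
[cite: BenfattoGiulianiMastropietro2003, §7.4 (s1.23)] -/
theorem card_fine_overlap_le {m m' : ℕ} (hmm : m ≤ m') (ω : Fin (sectorCount m)) :
    ((Finset.univ : Finset (Fin (sectorCount m'))).filter (fun ω' : Fin (sectorCount m') =>
      ∃ θ : ℝ, sectorWeightCirc m' ((ω' : ℕ) : ℤ) θ ≠ 0 ∧ sectorWeightCirc m ((ω : ℕ) : ℤ) θ ≠ 0)).card ≤ 9 * 2 ^ (m' - m) := by
  have hN : 0 < sectorCount m := sectorCount_pos m
  have hN' : 0 < sectorCount m' := sectorCount_pos m'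
  have hDpos : 0 < 2 ^ (m' - m) := by positivity
  -- the candidate map `((d, j), d′) ↦ ((2^{m′−m}·((ω + d − 1) mod N) + j) + d′ − 1) mod N′`
  let g : (Fin 3 × Fin (2 ^ (m' - m))) × Fin 3 → ℤ := fun t =>
    ((((2 ^ (m' - m) * ((((ω : ℕ) : ℤ) + ((t.1.1 : ℕ) : ℤ) - 1) % (sectorCount m : ℤ)).toNat + (t.1.2 : ℕ) : ℕ) : ℤ) +
      ((t.2 : ℕ) : ℤ) - 1) % (sectorCount m' : ℤ))
  have hg0 : ∀ t, 0 ≤ g t := fun t => Int.emod_nonneg _ (by exact_mod_cast hN'.ne')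
  have hg1 : ∀ t, g t < sectorCount m' := fun t => Int.emod_lt_of_pos _ (by exact_mod_cast hN')
  let f : (Fin 3 × Fin (2 ^ (m' - m))) × Fin 3 → Fin (sectorCount m') := fun t =>
    ⟨(g t).toNat, by have := hg0 t; have := hg1 t; omega⟩
  have hsub : (Finset.univ : Finset (Fin (sectorCount m'))).filter (fun ω' : Fin (sectorCount m') =>
      ∃ θ : ℝ, sectorWeightCirc m' ((ω' : ℕ) : ℤ) θ ≠ 0 ∧ sectorWeightCirc m ((ω : ℕ) : ℤ) θ ≠ 0) ⊆ Finset.univ.image f := by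
    intro ω' hω'
    rw [Finset.mem_filter] at hω'
    obtain ⟨θ, h1, h2⟩ := hω'.2
    obtain ⟨d', hd', hdiv'⟩ := sectorIndex_near_of_sectorWeightCirc_ne_zero h1
    obtain ⟨d, hd, hdiv⟩ := sectorIndex_near_of_sectorWeightCirc_ne_zero h2
    rw [Finset.mem_image]
    have hd'r : 0 ≤ 1 - d' ∧ 1 - d' ≤ 2 := by rw [abs_le] at hd'; omega
    have hdr : 0 ≤ 1 + d ∧ 1 + d ≤ 2 := by rw [abs_le] at hd; omega
    have hslt : sectorIndex m θ < sectorCount m := sectorIndex_lt m θ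
    have hs'lt : sectorIndex m' θ < sectorCount m' := sectorIndex_lt m' θ
    have hss' : sectorIndex m θ = sectorIndex m' θ / 2 ^ (m' - m) := sectorIndex_div_pow hmm θ
    have hj : sectorIndex m' θ % 2 ^ (m' - m) < 2 ^ (m' - m) := Nat.mod_lt _ hDpos
    have hdecomp : sectorIndex m' θ = 2 ^ (m' - m) * sectorIndex m θ + sectorIndex m' θ % 2 ^ (m' - m) := by
      rw [hss']; exact (Nat.div_add_mod _ _).symm
    refine ⟨((⟨(1 + d).toNat, by omega⟩, ⟨sectorIndex m' θ % 2 ^ (m' - m), hj⟩), ⟨(1 - d').toNat, by omega⟩),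
      Finset.mem_univ _, ?_⟩
    apply Fin.ext
    show (g ((⟨(1 + d).toNat, by omega⟩, ⟨sectorIndex m' θ % 2 ^ (m' - m), hj⟩), ⟨(1 - d').toNat, by omega⟩)).toNat = (ω' : ℕ)
    -- the coarse index from `ω`: `s = (ω + d) mod N`
    have hc : (((1 + d).toNat : ℕ) : ℤ) = 1 + d := Int.toNat_of_nonneg hdr.1
    have hsZ : ((sectorIndex m θ : ℕ) : ℤ) = (((ω : ℕ) : ℤ) + (((1 + d).toNat : ℕ) : ℤ) - 1) % (sectorCount m : ℤ) := by
      rw [hc]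
      have := eq_emod_of_dvd_sub (s := ((ω : ℕ) : ℤ) + d) (ω := ((sectorIndex m θ : ℕ) : ℤ)) (d := 0) (by positivity)
        (by exact_mod_cast hslt) (by obtain ⟨q, hq⟩ := hdiv; exact ⟨-q, by linarith⟩)
      rw [this]; ring_nf
    have htoNat : ((((ω : ℕ) : ℤ) + (((1 + d).toNat : ℕ) : ℤ) - 1) % (sectorCount m : ℤ)).toNat = sectorIndex m θ := by
      rw [← hsZ]; simp
    -- `ω′ = (s′ − d′) mod N′`
    have hω'lt : ((ω' : ℕ) : ℤ) < sectorCount m' := by exact_mod_cast ω'.isLt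
    have hc' : (((1 - d').toNat : ℕ) : ℤ) = 1 - d' := Int.toNat_of_nonneg hd'r.1
    have hω' : ((ω' : ℕ) : ℤ) = (((sectorIndex m' θ : ℕ) : ℤ) + (((1 - d').toNat : ℕ) : ℤ) - 1) % (sectorCount m' : ℤ) := by
      rw [hc']
      have := eq_emod_of_dvd_sub (s := ((sectorIndex m' θ : ℕ) : ℤ)) (ω := ((ω' : ℕ) : ℤ)) (d := d') (by positivity) hω'lt hdiv'
      rw [this]; ring_nf
    have hgval : g ((⟨(1 + d).toNat, by omega⟩, ⟨sectorIndex m' θ % 2 ^ (m' - m), hj⟩), ⟨(1 - d').toNat, by omega⟩) =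
        (((sectorIndex m' θ : ℕ) : ℤ) + (((1 - d').toNat : ℕ) : ℤ) - 1) % (sectorCount m' : ℤ) := by
      show ((((2 ^ (m' - m) * ((((ω : ℕ) : ℤ) + (((1 + d).toNat : ℕ) : ℤ) - 1) % (sectorCount m : ℤ)).toNat +
          sectorIndex m' θ % 2 ^ (m' - m) : ℕ) : ℤ) + (((1 - d').toNat : ℕ) : ℤ) - 1) % (sectorCount m' : ℤ)) = _
      rw [htoNat, ← hdecomp]
    rw [hgval, ← hω']
    simp
  calc _ ≤ (Finset.univ.image f).card := Finset.card_le_card hsub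
    _ ≤ (Finset.univ : Finset ((Fin 3 × Fin (2 ^ (m' - m))) × Fin 3)).card := Finset.card_image_le
    _ = 9 * 2 ^ (m' - m) := by simp; ring

/-! ## §3 The engine's families on a frame: overlap counts uniform in the frame -/

section Frame

variable (L M : ℕ) {e₀ : ℝ} (he : 0 < e₀) (β μ : ℝ) (K : TrigPolyC4v)
include he

/-- **Aniso–aniso, coarse side**: a sector of `klAnisoFamily … n′` meets at most `9` sectors of `klAnisoFamily … n`, `n ≤ n′` — on every
frame, uniformly in `β, μ, L, M`. [cite: BenfattoGiulianiMastropietro2006, §2.7 (2.71a)] -/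
theorem card_overlap_klAnisoFamily_coarse_le {n n' : ℕ} (hnn : n ≤ n') (ω' : Fin (sectorCount n')) :
    ((Finset.univ : Finset (Fin (sectorCount n))).filter (fun ω : Fin (sectorCount n) =>
      ∃ k : FreqMomentum L M, klAnisoFamily L M β μ K e₀ n' ω' k ≠ 0 ∧ klAnisoFamily L M β μ K e₀ n ω k ≠ 0)).card ≤ 9 := by
  refine le_trans (Finset.card_le_card (Finset.monotone_filter_right _ fun ω _ hω => ?_)) (card_coarse_overlap_le hnn ω')
  obtain ⟨k, h1, h2⟩ := hω
  exact ⟨momentumAngle L k.2, (support_klAnisoFamily L M he β μ K n' ω' k h1).2.2,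
    (support_klAnisoFamily L M he β μ K n ω k h2).2.2⟩

/-- **Aniso–aniso, fine side**: a sector of `klAnisoFamily … n` meets at most `9·2^{n′−n}` sectors of `klAnisoFamily … n′`, `n ≤ n′`.
[cite: BenfattoGiulianiMastropietro2006, §2.7 (2.71a)] -/
theorem card_overlap_klAnisoFamily_fine_le {n n' : ℕ} (hnn : n ≤ n') (ω : Fin (sectorCount n)) :
    ((Finset.univ : Finset (Fin (sectorCount n'))).filter (fun ω' : Fin (sectorCount n') =>
      ∃ k : FreqMomentum L M, klAnisoFamily L M β μ K e₀ n' ω' k ≠ 0 ∧ klAnisoFamily L M β μ K e₀ n ω k ≠ 0)).card ≤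
      9 * 2 ^ (n' - n) := by
  refine le_trans (Finset.card_le_card (Finset.monotone_filter_right _ fun ω' _ hω' => ?_)) (card_fine_overlap_le hnn ω)
  obtain ⟨k, h1, h2⟩ := hω'
  exact ⟨momentumAngle L k.2, (support_klAnisoFamily L M he β μ K n' ω' k h1).2.2,
    (support_klAnisoFamily L M he β μ K n ω k h2).2.2⟩

/-- **Iso–iso, coarse side** (angular indices `2n ≤ 2n′`): at most `9`. [cite: BenfattoGiulianiMastropietro2006, §2.5 (2.57)] -/
theorem card_overlap_klIsoFamily_coarse_le {n n' : ℕ} (hnn : n ≤ n') (ω' : Fin (sectorCount (2 * n'))) :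
    ((Finset.univ : Finset (Fin (sectorCount (2 * n)))).filter (fun ω : Fin (sectorCount (2 * n)) =>
      ∃ k : FreqMomentum L M, klIsoFamily L M β μ K e₀ n' ω' k ≠ 0 ∧ klIsoFamily L M β μ K e₀ n ω k ≠ 0)).card ≤ 9 := by
  refine le_trans (Finset.card_le_card (Finset.monotone_filter_right _ fun ω _ hω => ?_))
    (card_coarse_overlap_le (by omega) ω')
  obtain ⟨k, h1, h2⟩ := hω
  exact ⟨momentumAngle L k.2, (support_klIsoFamily L M he β μ K n' ω' k h1).2.2,
    (support_klIsoFamily L M he β μ K n ω k h2).2.2⟩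

/-- **Iso–iso, fine side**: at most `9·2^{2n′−2n}` = `9·4^{n′−n}`. [cite: BenfattoGiulianiMastropietro2006, §2.5 (2.57)] -/
theorem card_overlap_klIsoFamily_fine_le {n n' : ℕ} (hnn : n ≤ n') (ω : Fin (sectorCount (2 * n))) :
    ((Finset.univ : Finset (Fin (sectorCount (2 * n')))).filter (fun ω' : Fin (sectorCount (2 * n')) =>
      ∃ k : FreqMomentum L M, klIsoFamily L M β μ K e₀ n' ω' k ≠ 0 ∧ klIsoFamily L M β μ K e₀ n ω k ≠ 0)).card ≤
      9 * 2 ^ (2 * n' - 2 * n) := by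
  refine le_trans (Finset.card_le_card (Finset.monotone_filter_right _ fun ω' _ hω' => ?_))
    (card_fine_overlap_le (by omega) ω)
  obtain ⟨k, h1, h2⟩ := hω'
  exact ⟨momentumAngle L k.2, (support_klIsoFamily L M he β μ K n' ω' k h1).2.2,
    (support_klIsoFamily L M he β μ K n ω k h2).2.2⟩

/-- **Iso inside aniso at the same scale** (angular indices `n ≤ 2n`): an anisotropic sector of scale `n` meets at most `9·2ⁿ` isotropic
sectors of scale `n`, and an isotropic one meets at most `9` anisotropic ones. [cite: BenfattoGiulianiMastropietro2006, §2.5 (2.57)] -/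
theorem card_overlap_klIso_in_klAniso_le (n : ℕ) (ω : Fin (sectorCount n)) :
    ((Finset.univ : Finset (Fin (sectorCount (2 * n)))).filter (fun ω' : Fin (sectorCount (2 * n)) =>
      ∃ k : FreqMomentum L M, klIsoFamily L M β μ K e₀ n ω' k ≠ 0 ∧ klAnisoFamily L M β μ K e₀ n ω k ≠ 0)).card ≤
      9 * 2 ^ (2 * n - n) := by
  refine le_trans (Finset.card_le_card (Finset.monotone_filter_right _ fun ω' _ hω' => ?_))
    (card_fine_overlap_le (by omega) ω)
  obtain ⟨k, h1, h2⟩ := hω'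
  exact ⟨momentumAngle L k.2, (support_klIsoFamily L M he β μ K n ω' k h1).2.2,
    (support_klAnisoFamily L M he β μ K n ω k h2).2.2⟩

/-- **Aniso around iso at the same scale**: an isotropic sector of scale `n` meets at most `9` anisotropic sectors of scale `n`.
[cite: BenfattoGiulianiMastropietro2006, §2.5 (2.57)] -/
theorem card_overlap_klAniso_of_klIso_le (n : ℕ) (ω' : Fin (sectorCount (2 * n))) :
    ((Finset.univ : Finset (Fin (sectorCount n))).filter (fun ω : Fin (sectorCount n) =>
      ∃ k : FreqMomentum L M, klIsoFamily L M β μ K e₀ n ω' k ≠ 0 ∧ klAnisoFamily L M β μ K e₀ n ω k ≠ 0)).card ≤ 9 := by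
  refine le_trans (Finset.card_le_card (Finset.monotone_filter_right _ fun ω _ hω => ?_))
    (card_coarse_overlap_le (show n ≤ 2 * n by omega) ω')
  obtain ⟨k, h1, h2⟩ := hω
  exact ⟨momentumAngle L k.2, (support_klIsoFamily L M he β μ K n ω' k h1).2.2,
    (support_klAnisoFamily L M he β μ K n ω k h2).2.2⟩

end Frame

end Summit.HubbardSuperconductivity.HubbardSuperconductivity.Theorems.PerturbedFermiCurve

end
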